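import Literature.Analysis.FluidPDE.CollisionalTransfer
import HarnessLib

/-!
# `ClampedEntropyClock` (stmt-AtomisticToContinuum-15145), line `IdeatorTwoSketch`: the collision jump of the local-Gibbs one-body exponent (dock step (i), helper; lead prover-line-stmt-AtomisticToContinuum-15145-c1-0)

Step (i) of the entropy clock (`TwoClocks.ClampedWindowDock` docstring: "log ψ_t changes by kinetic terms between
collisions and by `[λ_t(x_i) − λ_t(x_j)]·Δη_i` at collisions, i.e. a collisionSum with weights ∇λ_t") in its
pathwise, antecedent-free form. On the hard-sphere domain the logarithm of a local Gibbs density is, up to the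
partition constant, the one-body sum `Σ_k g(x_k, v_k)` with
`g(x, v) = log b(x) − (3/2) log(2π ϑ(x)) − ‖v − w(x)‖² / (2 ϑ(x))`
(`EntropyClockDock.log_canonicalDensity_localGibbsProfile`, `EntropyClockDock.ae_logRatio_eq_oneBody`). Along a
hard-sphere trajectory this sum changes between collisions by the streaming terms (Euler in entropy variables,
`QuenchedCellClock.stub_entropyVariablesProduction`, landed) and AT a binary collision of the pair `{i, j}` by the
explicit jump proved here:

`Δ Σ_k g = ⟪w(x_i)/ϑ(x_i) − w(x_j)/ϑ(x_j), Δv_i⟫ − (ϑ(x_i)⁻¹ − ϑ(x_j)⁻¹) · (‖v_i⁺‖² − ‖v_i⁻‖²)/2`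

— the momentum transfer weighted by the difference of the entropy variable `λ^m = w/ϑ` and the energy transfer
weighted by the difference of `λ^e = −1/ϑ` between the two partners (momentum and energy conservation in the pair;
positions and the other particles do not jump). General geometry with Hausdorff positions and continuous
translations (true on `𝕋³`), general dimension, arbitrary profiles with `ϑ ≠ 0`. No Theses declaration is
asserted; a restatement-agnostic helper of the clock (consumed by the one-window step of any re-filing).
-/

open Set Filter Topology Function
open scoped InnerProductSpace

namespace Summit.AtomisticToContinuum.HydrodynamicLimit.Theorems.QuenchedCellClock

open Literature.Analysis.FluidPDE

noncomputable section

variable {d : Type*} [Fintype d] {X : Type*} {N : ℕ}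

/-- Bookkeeping split of the local-Gibbs one-body exponent: for `ϑ ≠ 0`,
`Σ_k [log b − (3/2) log(2πϑ) − ‖v − w‖²/(2ϑ)](x_k, v_k) = Σ_k c(x_k) + Σ_k ⟪w(x_k)/ϑ(x_k), v_k⟫ − Σ_k ϑ(x_k)⁻¹‖v_k‖²/2`
with the position-only part `c = log b − (3/2) log(2πϑ) − ‖w‖²/(2ϑ)`, i.e. `momentumObservable (ϑ⁻¹ • w)` minus
`energyObservable ϑ⁻¹` plus a function of the positions (expand `‖v − w‖² = ‖v‖² − 2⟪v, w⟫ + ‖w‖²`). [folklore] -/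
theorem sum_localGibbsExponent_eq (b ϑ : X → ℝ) (w : X → EuclideanSpace ℝ d) (hϑ : ∀ x, ϑ x ≠ 0)
    (z : Config N d X) :
    ∑ k, (Real.log (b (z k).1) - 3 / 2 * Real.log (2 * Real.pi * ϑ (z k).1) -
        ‖(z k).2 - w (z k).1‖ ^ 2 / (2 * ϑ (z k).1)) =
      ∑ k, (Real.log (b (z k).1) - 3 / 2 * Real.log (2 * Real.pi * ϑ (z k).1) -
          ‖w (z k).1‖ ^ 2 / (2 * ϑ (z k).1)) +
        momentumObservable (fun x => (ϑ x)⁻¹ • w x) z - energyObservable (fun x => (ϑ x)⁻¹) z := by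
  unfold momentumObservable energyObservable
  rw [← Finset.sum_add_distrib, ← Finset.sum_sub_distrib]
  refine Finset.sum_congr rfl fun k _ => ?_
  have hk := hϑ (z k).1
  rw [@norm_sub_sq_real, inner_smul_left, real_inner_comm]
  simp only [RCLike.conj_to_real]
  field_simp
  ring

/-- **Collision jump of the local-Gibbs one-body exponent.** Along a hard-sphere trajectory (Hausdorff positions,
continuous translations), for profiles `b, w` and `ϑ ≠ 0`, at a binary collision of the pair `{i, j}` the sum
`Σ_k [log b − (3/2) log(2πϑ) − ‖v − w‖²/(2ϑ)](x_k, v_k)` jumps by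
`⟪w(x_i)/ϑ(x_i) − w(x_j)/ϑ(x_j), v_i⁺ − v_i⁻⟫ − (ϑ(x_i)⁻¹ − ϑ(x_j)⁻¹)(‖v_i⁺‖² − ‖v_i⁻‖²)/2`:
the position-only part does not jump (`leftLim_apply_fst`), the momentum observable jumps by
`collisionJump_momentumObservable` and the energy observable by `collisionJump_energyObservable`. This is the
collisional part of the entropy production of Yau's clock: a collision sum weighted by the DIFFERENCES of the
entropy variables `w/ϑ` and `−1/ϑ` across the contact (of size `≍ ε‖∇λ‖` per collision).
[cite: OllaVaradhanYau1993, §3] -/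
theorem collisionJump_sum_localGibbsExponent [TopologicalSpace X] [T2Space X] {G : Geometry d X} {ε : ℝ}
    {γ : ℝ → Config N d X} (h : IsHardSphereTrajectory G ε N γ)
    (hG : ∀ x : X, Continuous (G.translate x)) (b ϑ : X → ℝ) (w : X → EuclideanSpace ℝ d)
    (hϑ : ∀ x, ϑ x ≠ 0) {t : ℝ} {i j : Fin N} (hij : i ≠ j) (hc : γ t ∈ contactSet G N ε i j) :
    collisionJump (fun z : Config N d X => ∑ k, (Real.log (b (z k).1) -
        3 / 2 * Real.log (2 * Real.pi * ϑ (z k).1) - ‖(z k).2 - w (z k).1‖ ^ 2 / (2 * ϑ (z k).1))) γ t =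
      ⟪(ϑ (γ t i).1)⁻¹ • w (γ t i).1 - (ϑ (γ t j).1)⁻¹ • w (γ t j).1,
          (γ t i).2 - (Function.leftLim γ t i).2⟫_ℝ -
        ((ϑ (γ t i).1)⁻¹ - (ϑ (γ t j).1)⁻¹) *
          ((‖(γ t i).2‖ ^ 2 - ‖(Function.leftLim γ t i).2‖ ^ 2) / 2) := by
  have hpos : ∀ k, (Function.leftLim γ t k).1 = (γ t k).1 := h.leftLim_apply_fst hG t
  have hm := h.collisionJump_momentumObservable hG (fun x => (ϑ x)⁻¹ • w x) hij hc
  have he := h.collisionJump_energyObservable hG (fun x => (ϑ x)⁻¹) hij hc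
  simp only [collisionJump] at hm he ⊢
  rw [sum_localGibbsExponent_eq b ϑ w hϑ, sum_localGibbsExponent_eq b ϑ w hϑ]
  have hc0 : ∑ k, (Real.log (b (γ t k).1) - 3 / 2 * Real.log (2 * Real.pi * ϑ (γ t k).1) -
        ‖w (γ t k).1‖ ^ 2 / (2 * ϑ (γ t k).1)) =
      ∑ k, (Real.log (b (Function.leftLim γ t k).1) -
        3 / 2 * Real.log (2 * Real.pi * ϑ (Function.leftLim γ t k).1) -
        ‖w (Function.leftLim γ t k).1‖ ^ 2 / (2 * ϑ (Function.leftLim γ t k).1)) := by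
    simp only [hpos]
  rw [hc0]
  linear_combination hm - he

end

end Summit.AtomisticToContinuum.HydrodynamicLimit.Theorems.QuenchedCellClock
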